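import Summits.QuantumFields.YangMills.Theorems.AllWindowsColdBoxBoxHighLineK3PrimeRowWilsonSextic
import Summits.QuantumFields.YangMills.Theorems.AllWindowsColdBoxBoxHighLinePhiQuarticLocalForm
import Summits.QuantumFields.YangMills.Theorems.AllWindowsColdBoxBoxHighLineTiltUEvenL2Prelims
import Summits.QuantumFields.YangMills.Theorems.AllWindowsColdBoxBoxHighLineTiltTruncation
import Summits.QuantumFields.YangMills.Theorems.AllWindowsColdBoxBoxHighLineSmallFieldInsideFPCore
import Summits.QuantumFields.YangMills.Theorems.AllWindowsColdBoxBoxHighLineCum3TriangleMuSet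

/-!
# U5 K3′ — the two remaining «sup × L²» pieces of row RA: the Φ-SEXTIC remainder and the HAAR-QUARTIC remainder slots of `κ₃,₀^{μ_D}(L_x, L_y; ·)`
# (planner ym-idea-2 g19's Q8 closure 2026-08-30T01:44:58Z: «w4 g30: ★(iv) `abs_tiltCum3_muSet_phiRem_le`, ★(v) `abs_tiltCum3_muSet_haarRem_le`»;
# K3′ term table of record = fcl-p3 g27's row RA of ✓`abs_tiltCum3_muSet_tiltU_le_rows`; LINE-20 U5 ⟨stmt-QuantumFields-24336⟩ — U5 prep, helper-grade)

Extra width seat `ym-line-sfw-p2-w4` (g30).  Row RA of the hK3 row-sum is `κ₃(L_x, L_y; Re)` with the even remainder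
`Re = Uᵉ − (quadVal ghostM + Haar₂ + Vr)` = (Wilson sextic) + (Φ sextic) + (ghost even beyond `quadVal`) + (Haar beyond Haar₂).  The Wilson piece is
✓`GaussRestrict.abs_tiltCum3_muSet_wilsonSexticRow_le` (part 1, `…K3PrimeRowWilsonSextic`), the ghost piece is w5 g24's 7d⁽⁴⁾ row; here, both as instances of
the generic ✓`GaussRestrict.abs_tiltCum3_muSet_linCurvSq_linCurvSq_le_of_sup`:

* ★ `GaussRestrict.abs_tiltCum3_muSet_phiRem_le` — tilt slot `−β·(Φ∘chart − divLinSq − phiQuartic)` (= the Φ-summand of `tiltU` minus its quadratic and quartic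
  vertices), `sup ≤ C_Φ·β·H⁴·s⁶` on `smallField H s` by ✓`phiTaylor` clause 3 (`C_Φ = 3072`): `≤ C·H⁴·(1+log H)²·s⁶/β` — the SAME shape as the Wilson sextic row,
  so its β-letter budget is ✓`GaussRestrict.wilsonSexticRow_budget` verbatim (row (K7) `21θ/2 < 5/4`);
* ★ `GaussRestrict.abs_tiltCum3_muSet_haarRem_le` — tilt slot `haarLogRatio − quadVal(−(1/3)·1)` (Haar beyond Haar₂), `sup ≤ C_h·|LandauFree H|·s⁴ ≤ 216·C_h·H⁴·s⁴`
  by ✓`GaussNormalForm.abs_haarLogRatio_sub_quadVal_le` + ✓`SmallFieldFP.card_landauFree_le`: `≤ C·H⁴·(1+log H)²·s⁴/β²`;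
* ★ `GaussRestrict.abs_phiRem_le_of_mem_smallField`, `GaussRestrict.abs_haarRem_le_of_mem_smallField` — the two ν-SUPPLIERS as sup bounds on `smallField H s`
  in `H`-power form (`C_Φ·H⁴·s⁶`, `216·C_h·H⁴·s⁴`), for fcl-p3 g27's single RA row over the total even remainder;
* ★ `GaussRestrict.abs_tiltCum3_muSet_quarticWilsonRem_le` — the Wilson-sextic piece again, in the `quarticWilson` LETTER and generic in the polynomial part
  `W4` (`|quarticWilson − W4| ≤ C_R·β·H⁴·s⁶` on the small field, e.g. w3 g42's `Q` of record with `C_R = 81920`): `≤ C·C_R·H⁴(1+log H)²s⁶/β`;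
* ★ `GaussRestrict.haarRem_budget` — `β²H⁸·(C·H⁴(1+log H)²s⁴/β²) ≤ ε` eventually at `s = β^{(1/8−θ/4)−1/2}`, row **`11θ < 3/2 ⟺ θ < 3/22`** ✓ for `θ < 1/10`.

No definitions; tree only; standard axioms.  HONEST LABEL: helper-grade glue for two remainder pieces of row RA of the open size hypothesis `hK3`; `hK3`, U5
`stub_landauThirdOrder`, ⟨24336⟩, ⟨24004⟩ and this seat's crux ⟨stmt-QuantumFields-22884⟩ remain OPEN; route AllWindowsColdBox is DRAFT; no crux, rung or summit is
proved; **the Yang–Mills mass gap is NOT proved by this file; no summit is proved by a line.**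
-/

set_option autoImplicit false

noncomputable section

open MeasureTheory Set
open Literature.Probability.LatticeModels (Site)
open Summit.QuantumFields.YangMills.Theorems.WeakCouplingRates (plaq12At)

namespace Summit.QuantumFields.YangMills.Theorems.AllWindowsColdBoxBoxHighLine

namespace GaussRestrict

/-! ## The two ν-suppliers on the small-field set (sup bounds, `H`-power form) -/

/-- ★ **Φ-sextic ν-supplier**: on `smallField H s`, `0 ≤ s ≤ 1`, `H ≥ 1`: `|Φ(U(a)) − divLinSq a − phiQuartic a| ≤ C_Φ·H⁴·s⁶` (✓`phiTaylor` clause 3, `C_Φ ≥ 0`). -/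
theorem abs_phiRem_le_of_mem_smallField : ∃ C : ℝ, 0 ≤ C ∧ ∀ H : ℕ, 1 ≤ H → ∀ s : ℝ, 0 ≤ s → s ≤ 1 → ∀ a ∈ smallField H s,
    |landauPhi H (edgeChart H a) - divLinSq H a - phiQuartic H a| ≤ C * (H : ℝ) ^ 4 * s ^ 6 := by
  obtain ⟨CΦ, hΦ⟩ := phiTaylor
  have hCΦ : 0 ≤ CΦ := by
    have h := (hΦ 1 le_rfl 0).2.2 1 zero_le_one le_rfl (fun e => by simp)
    have : (0 : ℝ) ≤ CΦ * ((1 : ℕ) : ℝ) ^ 4 * 1 ^ 6 := (abs_nonneg _).trans h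
    simpa using this
  exact ⟨CΦ, hCΦ, fun H hH s hs0 hs1 a ha => (hΦ H hH a).2.2 s hs0 hs1 fun e => ha e⟩

/-- ★ **Haar-quartic ν-supplier**: on `smallField H s`, `0 ≤ s ≤ 1`, `H ≥ 1`: `|haarLogRatio a − quadVal(−(1/3)·1) a| ≤ C·H⁴·s⁴`
(✓`GaussNormalForm.abs_haarLogRatio_sub_quadVal_le` with `|LandauFree H| ≤ 216·H⁴` ✓`SmallFieldFP.card_landauFree_le`). -/
theorem abs_haarRem_le_of_mem_smallField : ∃ C : ℝ, 0 ≤ C ∧ ∀ H : ℕ, 1 ≤ H → ∀ s : ℝ, 0 ≤ s → s ≤ 1 → ∀ a ∈ smallField H s,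
    |haarLogRatio H a - quadVal ((-(1 / 3 : ℝ)) • (1 : Matrix (LandauFree H × Fin 3) (LandauFree H × Fin 3) ℝ)) a| ≤ C * (H : ℝ) ^ 4 * s ^ 4 := by
  obtain ⟨Ch, hCh0, hh⟩ := GaussNormalForm.abs_haarLogRatio_sub_quadVal_le
  refine ⟨Ch * 216, by positivity, fun H hH s hs0 hs1 a ha => (hh H s hs0 hs1 a ha).trans ?_⟩
  have hcard := SmallFieldFP.card_landauFree_le (H := H) hH
  have h0 : 0 ≤ Ch * s ^ 4 := by positivity
  calc Ch * (Fintype.card (LandauFree H) : ℝ) * s ^ 4 = (Fintype.card (LandauFree H) : ℝ) * (Ch * s ^ 4) := by ring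
    _ ≤ 216 * (H : ℝ) ^ 4 * (Ch * s ^ 4) := mul_le_mul_of_nonneg_right hcard h0
    _ = Ch * 216 * (H : ℝ) ^ 4 * s ^ 4 := by ring

/-! ## The Φ-sextic remainder slot -/

/-- ★ **Row RA, Φ-sextic piece**: for `H ≥ 1`, `β > 0`, `0 ≤ s ≤ 1`, every measurable `D ⊆ smallField H s` with `E₀[1 − 1_D] ≤ τ ≤ 1/2`, all base points:
`|κ₃,₀^{μ_D}(L_x, L_y; −β·(Φ∘chart − divLinSq − phiQuartic))| ≤ C·H⁴·(1+log H)²·s⁶/β` (✓`phiTaylor` clause 3 for the sup, the generic sup×L² row for the rest). -/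
theorem abs_tiltCum3_muSet_phiRem_le : ∃ C : ℝ, 0 ≤ C ∧ ∀ H : ℕ, 1 ≤ H → ∀ β : ℝ, 0 < β → ∀ s : ℝ, 0 ≤ s → s ≤ 1 →
    ∀ D : Set (LandauFree H → E3), MeasurableSet D → D ⊆ smallField H s →
    ∀ τ : ℝ, gaussAvg β H (fun a => 1 - D.indicator (fun _ => (1 : ℝ)) a) ≤ τ → τ ≤ 1 / 2 → ∀ x y : Site 4,
    |Tilt.tiltCum3 ((((volume : Measure (LandauFree H → E3)).restrict D).withDensity fun a => ENNReal.ofReal (gaussWeight β H a)))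
        (fun a => -(β * (landauPhi H (edgeChart H a) - divLinSq H a - phiQuartic H a))) 0
        (linCurvSq H (plaq12At x)) (linCurvSq H (plaq12At y))| ≤ C * (H : ℝ) ^ 4 * (1 + Real.log H) ^ 2 * s ^ 6 / β := by
  obtain ⟨C, hC0, hrow⟩ := abs_tiltCum3_muSet_linCurvSq_linCurvSq_le_of_sup
  obtain ⟨CΦ, hCΦ, hΦ⟩ := abs_phiRem_le_of_mem_smallField
  refine ⟨C * CΦ, by positivity, fun H hH β hβ s hs0 hs1 D hDm hDs τ hτ hτ2 x y => ?_⟩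
  have mN : Measurable fun a : LandauFree H → E3 => -(β * (landauPhi H (edgeChart H a) - divLinSq H a - phiQuartic H a)) :=
    ((((GaussNormalForm.measurable_landauPhi_edgeChart H).sub (GaussNormalForm.measurable_divLinSq H)).sub
      (PhiQuartic.measurable_phiQuartic H)).const_mul β).neg
  have bN : ∀ a ∈ D, |-(β * (landauPhi H (edgeChart H a) - divLinSq H a - phiQuartic H a))| ≤ CΦ * β * (H : ℝ) ^ 4 * s ^ 6 := by
    intro a ha
    rw [abs_neg, abs_mul, abs_of_pos hβ]
    calc β * |landauPhi H (edgeChart H a) - divLinSq H a - phiQuartic H a| ≤ β * (CΦ * (H : ℝ) ^ 4 * s ^ 6) :=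
          mul_le_mul_of_nonneg_left (hΦ H hH s hs0 hs1 a (hDs ha)) hβ.le
      _ = CΦ * β * (H : ℝ) ^ 4 * s ^ 6 := by ring
  have h := hrow H hH β hβ s hs0 D hDm hDs τ hτ hτ2 _ mN _ (by positivity) bN x y
  refine h.trans (le_of_eq ?_)
  field_simp

/-! ## The Haar-quartic remainder slot -/

/-- ★ **Row RA, Haar piece**: for `H ≥ 1`, `β > 0`, `0 ≤ s ≤ 1`, every measurable `D ⊆ smallField H s` with `E₀[1 − 1_D] ≤ τ ≤ 1/2`, all base points:
`|κ₃,₀^{μ_D}(L_x, L_y; haarLogRatio − quadVal(−(1/3)·1))| ≤ C·H⁴·(1+log H)²·s⁴/β²`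
(✓`GaussNormalForm.abs_haarLogRatio_sub_quadVal_le` + ✓`SmallFieldFP.card_landauFree_le` for the sup, the generic sup×L² row for the rest). -/
theorem abs_tiltCum3_muSet_haarRem_le : ∃ C : ℝ, 0 ≤ C ∧ ∀ H : ℕ, 1 ≤ H → ∀ β : ℝ, 0 < β → ∀ s : ℝ, 0 ≤ s → s ≤ 1 →
    ∀ D : Set (LandauFree H → E3), MeasurableSet D → D ⊆ smallField H s →
    ∀ τ : ℝ, gaussAvg β H (fun a => 1 - D.indicator (fun _ => (1 : ℝ)) a) ≤ τ → τ ≤ 1 / 2 → ∀ x y : Site 4,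
    |Tilt.tiltCum3 ((((volume : Measure (LandauFree H → E3)).restrict D).withDensity fun a => ENNReal.ofReal (gaussWeight β H a)))
        (fun a => haarLogRatio H a - quadVal ((-(1 / 3 : ℝ)) • (1 : Matrix (LandauFree H × Fin 3) (LandauFree H × Fin 3) ℝ)) a) 0
        (linCurvSq H (plaq12At x)) (linCurvSq H (plaq12At y))| ≤ C * (H : ℝ) ^ 4 * (1 + Real.log H) ^ 2 * s ^ 4 / β ^ 2 := by
  obtain ⟨C, hC0, hrow⟩ := abs_tiltCum3_muSet_linCurvSq_linCurvSq_le_of_sup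
  obtain ⟨Ch, hCh0, hh⟩ := abs_haarRem_le_of_mem_smallField
  refine ⟨C * Ch, by positivity, fun H hH β hβ s hs0 hs1 D hDm hDs τ hτ hτ2 x y => ?_⟩
  have mN : Measurable fun a : LandauFree H → E3 =>
      haarLogRatio H a - quadVal ((-(1 / 3 : ℝ)) • (1 : Matrix (LandauFree H × Fin 3) (LandauFree H × Fin 3) ℝ)) a :=
    (GaussNormalForm.measurable_haarLogRatio H).sub (measurable_quadVal _)
  have bN : ∀ a ∈ D, |haarLogRatio H a - quadVal ((-(1 / 3 : ℝ)) • (1 : Matrix (LandauFree H × Fin 3) (LandauFree H × Fin 3) ℝ)) a| ≤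
      Ch * (H : ℝ) ^ 4 * s ^ 4 := fun a ha => hh H hH s hs0 hs1 a (hDs ha)
  have h := hrow H hH β hβ s hs0 D hDm hDs τ hτ hτ2 _ mN _ (by positivity) bN x y
  refine h.trans (le_of_eq ?_)
  field_simp

/-! ## The Wilson sextic remainder slot in the `quarticWilson` letter (generic polynomial part `W4`) -/

/-- ★ **Row RA, Wilson-sextic piece in the `quarticWilson` letter, GENERIC in the quartic polynomial part**: for ANY measurable `W4` with
`|quarticWilson β H a − W4 a| ≤ C_R·β·H⁴·s⁶` on `smallField H s` (w3 g42's ✓`WilsonTaylor.exists_quarticTensor_quarticWilson` supplies the `Q` of record with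
`C_R = 81920`), every measurable `D ⊆ smallField H s` with `E₀[1 − 1_D] ≤ τ ≤ 1/2`, and all base points:
`|κ₃,₀^{μ_D}(L_x, L_y; −(quarticWilson − W4))| ≤ C·C_R·H⁴·(1+log H)²·s⁶/β` (companion of ✓`abs_tiltCum3_muSet_wilsonSexticRow_le`, which is the same row with
the slot written plaquette by plaquette). -/
theorem abs_tiltCum3_muSet_quarticWilsonRem_le : ∃ C : ℝ, 0 ≤ C ∧ ∀ H : ℕ, 1 ≤ H → ∀ β : ℝ, 0 < β → ∀ s : ℝ, 0 ≤ s → s ≤ 1 →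
    ∀ W4 : (LandauFree H → E3) → ℝ, Measurable W4 → ∀ CR : ℝ, 0 ≤ CR →
    (∀ a ∈ smallField H s, |quarticWilson β H a - W4 a| ≤ CR * β * (H : ℝ) ^ 4 * s ^ 6) →
    ∀ D : Set (LandauFree H → E3), MeasurableSet D → D ⊆ smallField H s →
    ∀ τ : ℝ, gaussAvg β H (fun a => 1 - D.indicator (fun _ => (1 : ℝ)) a) ≤ τ → τ ≤ 1 / 2 → ∀ x y : Site 4,
    |Tilt.tiltCum3 ((((volume : Measure (LandauFree H → E3)).restrict D).withDensity fun a => ENNReal.ofReal (gaussWeight β H a)))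
        (fun a => -(quarticWilson β H a - W4 a)) 0 (linCurvSq H (plaq12At x)) (linCurvSq H (plaq12At y))| ≤
      C * CR * (H : ℝ) ^ 4 * (1 + Real.log H) ^ 2 * s ^ 6 / β := by
  obtain ⟨C, hC0, hrow⟩ := abs_tiltCum3_muSet_linCurvSq_linCurvSq_le_of_sup
  refine ⟨C, hC0, fun H hH β hβ s hs0 hs1 W4 mW4 CR hCR hRem D hDm hDs τ hτ hτ2 x y => ?_⟩
  have mN : Measurable fun a : LandauFree H → E3 => -(quarticWilson β H a - W4 a) := ((GaussNormalForm.measurable_quarticWilson β H).sub mW4).neg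
  have bN : ∀ a ∈ D, |-(quarticWilson β H a - W4 a)| ≤ CR * β * (H : ℝ) ^ 4 * s ^ 6 := fun a ha => by
    rw [abs_neg]; exact hRem a (hDs ha)
  have h := hrow H hH β hβ s hs0 D hDm hDs τ hτ hτ2 _ mN _ (by positivity) bN x y
  refine h.trans (le_of_eq ?_)
  field_simp

/-! ## The β-letter budget of the Haar piece -/

open AssemblyBudget ErrorBudget in
/-- ★ **Budget of the Haar piece** at `s = β^{(1/8−θ/4)−1/2}`: for every `0 ≤ θ < 1/10`, any `C`, every `ε > 0`, eventually on the top slab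
`β²·H⁸·(C·H⁴·(1+log H)²·s⁴/β²) ≤ ε` — the exponent row at `κ₃ = 1/8 − θ/4`: `12θ < 4·(1/2 − κ₃)`, i.e. **`11θ < 3/2 ⟺ θ < 3/22`** (✓ for `θ < 1/10`).
(The Φ-sextic piece has the shape of the Wilson sextic row; its budget is ✓`wilsonSexticRow_budget`.) -/
theorem haarRem_budget {θ : ℝ} (hθ : 0 ≤ θ) (hθ' : θ < 1 / 10) (C : ℝ) {ε : ℝ} (hε : 0 < ε) :
    ∃ β₀ : ℝ, 1 ≤ β₀ ∧ ∀ β : ℝ, β₀ ≤ β → ∀ H : ℕ, 1 ≤ H → (H : ℝ) ≤ β ^ θ + 1 →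
      β ^ 2 * (H : ℝ) ^ 8 * (C * (H : ℝ) ^ 4 * (1 + Real.log H) ^ 2 * (β ^ ((1 / 8 - θ / 4) - 1 / 2)) ^ 4 / β ^ 2) ≤ ε := by
  obtain ⟨β₀, hβ₀, h⟩ := budget_monomial (a := 0) (k := 12) (j := 4) (κ₃ := 1 / 8 - θ / 4) hθ (by push_cast; linarith) hε C 2
  refine ⟨β₀, hβ₀, fun β hβ H hH hHu => ?_⟩
  have hβ0 : 0 < β := by linarith
  have e := h β hβ H hH hHu
  rw [Real.rpow_zero, mul_one] at e
  have hid : β ^ 2 * (H : ℝ) ^ 8 * (C * (H : ℝ) ^ 4 * (1 + Real.log H) ^ 2 * (β ^ ((1 / 8 - θ / 4) - 1 / 2)) ^ 4 / β ^ 2) =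
      C * (H : ℝ) ^ 12 * (1 + Real.log H) ^ 2 * (β ^ ((1 / 8 - θ / 4) - 1 / 2)) ^ 4 := by
    field_simp
  rw [hid]
  exact e

end GaussRestrict

end Summit.QuantumFields.YangMills.Theorems.AllWindowsColdBoxBoxHighLine
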